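import Summits.ResolutionOfSingularities.ResolutionOfSingularities.Theorems.FrobeniusLadderFInjectiveMacaulayficationCertifiedChartCentre
import Literature.AlgebraicGeometry.Resolution.BlowupAlgebraPrimesPoints
import Literature.AlgebraicGeometry.Resolution.BlowupsExistence
import Literature.AlgebraicGeometry.Resolution.MarkedIdeals
import Literature.AlgebraicGeometry.Dimension.PointDimension
import Mathlib.Topology.JacobsonSpace
import HarnessLib

/-!
# Certified charts are point-fixable: `P_cert ⇒ P_loc` — 5d of `ClassGlueSig` v3 (crux stmt-ResolutionOfSingularities-15315, chain w45a)

[OURS · L1 W4.5a · res-D-pv-019 AS res-L1-w45a-stub-7] Support file (`--supports stmt-ResolutionOfSingularities-15315 --as helper`)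
for the crux `FrobeniusLadder.FInjectiveMacaulayfication`; NOT a statement of any manuscript; AI-written, weaker than expert review.
Statement = 5d `stub_certifiedChart_pointFixable` of the planner's sketch file `L/w45a/ClassGlueSig.lean` v3 sha16 74b6a04e74c75940
(l.463–483) VERBATIM with the `stub_` prefix dropped (Sig: «OWNER: first free of res-L1-w45a-stub-3 / stub-7»; TAKING HOME/STATUS
2026-08-27T07:4xZ).

THE THEOREM (`certifiedChart_pointFixable`). For an admissible pair `X₁ → Spec k` (separated, locally of finite type, quasi-compact,
`X₁` integral, Cohen–Macaulay stalks, finitely many non-F-injective stalks) and a bad point `b` which is a CERTIFIED-CHART point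
(`P_cert`: inside every open `W ∋ b` an affine open `U ∋ b`, alone-bad, `char Γ(X₁, U) = p`, an ideal `I ≠ 0` with zero locus `{b}`
and E6‴-format cover certificates), the local ring `𝒪_{X₁,b}` is POINT-FIXABLE (`P_loc = PFix`): SOME `𝔪_b`-primary ideal `(c)`
(`(c) ≠ 0`, `√(c) = 𝔪_b`) all of whose affine blowup algebras `𝒪_b[(c)/c_j]` are domains + Cohen–Macaulay + Frobenius-closed at
every prime over `𝔪_b`.

PROOF (the SCHEME ROUTE of the Sig docstring). Take `W = ⊤`; `b` is closed in `X₁` ({b} = U ∩ cl{b} is locally closed by the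
zero-locus conjunct and specialisation = containment of primes on the affine `U`
(`Literature.AlgebraicGeometry.Dimension.Scheme.specializes_iff_primeIdealOf_le`); `X₁` is a Jacobson space, Mathlib
`LocallyOfFiniteType.jacobsonSpace`, `isClosed_singleton_of_isLocallyClosed_singleton`); the point-centre ideal sheaf `J` of `I`
(`PointCentreIdealSheaf.stub_pointCentreIdealSheaf`: `J(U) = I`, `supp J = {b}`) has every blowing up good over `b` (the body of
§2b `CertifiedChartCentre.pointCentreOfCoverCertificates`: `BlowupStalkOverAffine`, `ClauseOffCentre`, §2a
`CertifiedChartCentre.affineBlowupStalkClauseOfCover`); `c :=` the germs at `b` of generators of `I` (`Γ(X₁, U)` is Noetherian), so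
`(c) = I·𝒪_b = J_b` (`stalkIdeal_eq_map_germ`), `(c) ≠ 0` (germs are injective on an integral scheme) and `√(c) = 𝔪_b` (a prime of
the localization `𝒪_b = Γ(U)_{𝔭_b}` containing `I·𝒪_b` contracts to a prime `𝔮 ⊆ 𝔭_b` containing `I`, whose point lies in the zero
locus `{b}`, so `𝔮 = 𝔭_b`); finally for a chart `j` and a prime `𝔔` of `𝒪_b[(c)/c_j]` over `𝔪_b`, a blowing up `π : X' → X₁` along
`J` exists (`exists_isBlowup`) and `𝔔` is the local ring of a point `x' ∈ X'` over `b`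
(`IsBlowup.exists_point_of_blowupAlgebra_prime`, BlowupAlgebraPrimesPoints.lean — the converse of the tree's
`IsBlowup.exists_blowupAlgebra_stalk_ringEquiv`), whose full clause moves along the ring isomorphism (`fiClause_of_ringEquiv`).
Zero named facts, no `sorry`.
-/

-- single-problem summit: the doubled namespace component is forced
set_option linter.dupNamespace false

noncomputable section

namespace Summit.ResolutionOfSingularities.ResolutionOfSingularities.Theorems.FInjectiveMacaulayfication.CertifiedChartPointFixable

open AlgebraicGeometry CategoryTheory Literature.AlgebraicGeometry.Resolution TopologicalSpace IsLocalRing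
open Summit.ResolutionOfSingularities.ResolutionOfSingularities.Theorems.FInjectiveMacaulayfication

/-- A point `b` of an affine open `U` of a scheme locally of finite type over a field which is the zero locus in `U` of an ideal
`I ≤ Γ(X₁, U)` (the primes containing `I` are exactly the one of `b`) is a closed point of `X₁`: `{b} = U ∩ cl{b}` is locally
closed, and `X₁` is a Jacobson space. [folklore] -/
theorem isClosed_singleton_of_zeroLocus {k : Type} [Field k] {X₁ : Scheme.{0}} (f₁ : X₁ ⟶ Spec (.of k))
    [LocallyOfFiniteType f₁] (U : X₁.affineOpens) (I : Ideal Γ(X₁, U)) (b : X₁) (hbU : b ∈ (U : X₁.Opens))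
    (hzero : ∀ (x : X₁) (hx : x ∈ (U : X₁.Opens)), I ≤ (U.2.primeIdealOf ⟨x, hx⟩).asIdeal ↔ x = b) :
    IsClosed ({b} : Set X₁) := by
  haveI : JacobsonSpace X₁ := LocallyOfFiniteType.jacobsonSpace f₁
  apply isClosed_singleton_of_isLocallyClosed_singleton
  refine ⟨(U : Set X₁), closure {b}, U.1.isOpen, isClosed_closure, ?_⟩
  ext x
  constructor
  · rintro rfl
    exact ⟨hbU, subset_closure rfl⟩
  · rintro ⟨hxU, hx⟩
    have hbx : b ⤳ x := specializes_iff_mem_closure.mpr hx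
    have hle : U.2.primeIdealOf ⟨b, hbU⟩ ≤ U.2.primeIdealOf ⟨x, hxU⟩ :=
      (Literature.AlgebraicGeometry.Dimension.Scheme.specializes_iff_primeIdealOf_le U.2 ⟨b, hbU⟩ ⟨x, hxU⟩).mp hbx
    have hIb : I ≤ (U.2.primeIdealOf ⟨b, hbU⟩).asIdeal := (hzero b hbU).mpr rfl
    exact Set.mem_singleton_iff.mpr ((hzero x hxU).mp (hIb.trans hle))

/-- On an affine open `U ∋ b`: if the primes of `Γ(X₁, U)` containing `I` are exactly the one of `b`, then the extension
`I·𝒪_{X₁,b}` of `I` to the local ring (a localization of `Γ(X₁, U)` at `𝔭_b`) has radical `𝔪_b`. [folklore] -/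
theorem radical_map_germ_eq_maximalIdeal {X₁ : Scheme.{0}} (U : X₁.affineOpens) (I : Ideal Γ(X₁, U)) (b : X₁)
    (hbU : b ∈ (U : X₁.Opens))
    (hzero : ∀ (x : X₁) (hx : x ∈ (U : X₁.Opens)), I ≤ (U.2.primeIdealOf ⟨x, hx⟩).asIdeal ↔ x = b) :
    (I.map (X₁.presheaf.germ U b hbU).hom).radical = maximalIdeal (X₁.presheaf.stalk b) := by
  letI : Algebra Γ(X₁, U) (X₁.presheaf.stalk b) := (X₁.presheaf.germ U b hbU).hom.toAlgebra
  have hloc : IsLocalization.AtPrime (X₁.presheaf.stalk b) (U.2.primeIdealOf ⟨b, hbU⟩).asIdeal :=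
    U.2.isLocalization_stalk ⟨b, hbU⟩
  have halg : (X₁.presheaf.germ U b hbU).hom = algebraMap Γ(X₁, U) (X₁.presheaf.stalk b) := rfl
  have hIb : I ≤ (U.2.primeIdealOf ⟨b, hbU⟩).asIdeal := (hzero b hbU).mpr rfl
  rw [halg]
  apply le_antisymm
  · refine (Ideal.IsPrime.radical_le_iff inferInstance).mpr ?_
    rw [Ideal.map_le_iff_le_comap]
    intro g hg
    rw [Ideal.mem_comap]
    exact (IsLocalization.AtPrime.to_map_mem_maximal_iff (X₁.presheaf.stalk b)
      (U.2.primeIdealOf ⟨b, hbU⟩).asIdeal g).mpr (hIb hg)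
  · rw [Ideal.radical_eq_sInf]
    refine le_sInf ?_
    rintro Q ⟨hIQ, hQ⟩
    -- the contraction `𝔮` of `Q` is a prime of `Γ(X₁, U)` containing `I`, hence the prime of `b`
    let 𝔮 : PrimeSpectrum Γ(X₁, U) := ⟨Q.comap (algebraMap Γ(X₁, U) (X₁.presheaf.stalk b)), Ideal.comap_isPrime _ Q⟩
    have hxU : U.2.fromSpec 𝔮 ∈ (U : X₁.Opens) := PointCentreIdealSheaf.fromSpec_mem U.2 𝔮
    have hIq : I ≤ 𝔮.asIdeal := by
      change I ≤ Q.comap (algebraMap Γ(X₁, U) (X₁.presheaf.stalk b))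
      rw [← Ideal.map_le_iff_le_comap]
      exact hIQ
    have hx : U.2.fromSpec 𝔮 = b := (hzero _ hxU).mp (by
      rw [PointCentreIdealSheaf.primeIdealOf_fromSpec U.2 𝔮 hxU]
      exact hIq)
    have h𝔮 : 𝔮 = U.2.primeIdealOf ⟨b, hbU⟩ := by
      rw [← PointCentreIdealSheaf.primeIdealOf_fromSpec U.2 𝔮 hxU]
      congr 1
      exact Subtype.ext hx
    have hunder : Q.under Γ(X₁, U) = (U.2.primeIdealOf ⟨b, hbU⟩).asIdeal := congrArg PrimeSpectrum.asIdeal h𝔮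
    have hQ' : Q = maximalIdeal (X₁.presheaf.stalk b) := by
      rw [← IsLocalization.map_under (U.2.primeIdealOf ⟨b, hbU⟩).asIdeal.primeCompl (X₁.presheaf.stalk b) Q, hunder,
        IsLocalization.AtPrime.map_eq_maximalIdeal (U.2.primeIdealOf ⟨b, hbU⟩).asIdeal (X₁.presheaf.stalk b)]
    rw [hQ']

/-- **5d — CERTIFIED CHARTS ARE POINT-FIXABLE** (`P_cert ⇒ P_loc`; `ClassGlueSig` v3 74b6a04e74c75940 `stub_certifiedChart_pointFixable`,
verbatim): at a bad point `b` of an admissible pair carrying a certified chart inside every open neighbourhood, the local ring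
`𝒪_{X₁,b}` has an `𝔪_b`-primary ideal `(c) ≠ 0` all of whose affine blowup algebras `𝒪_b[(c)/c_j]` are domains, Cohen–Macaulay
and Frobenius-closed at every prime over `𝔪_b`. Scheme route: point-centre ideal sheaf of the chart ideal, §2a/§2b of
`CertifiedChartCentre`, and the chart-prime ↔ blow-up-point dictionary `IsBlowup.exists_point_of_blowupAlgebra_prime`. [folklore] -/
theorem certifiedChart_pointFixable : ∀ (p : ℕ), p.Prime → ∀ (k : Type) [Field k] [CharP k p]
    (X₁ : Scheme.{0}) (f₁ : X₁ ⟶ Spec (.of k)),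
      IsSeparated f₁ → LocallyOfFiniteType f₁ → QuasiCompact f₁ → IsIntegral X₁ →
      (∀ x : X₁, ∀ d : ℕ, ringKrullDim (X₁.presheaf.stalk x) = d → ∀ s : Fin d → X₁.presheaf.stalk x, (Ideal.span (Set.range s)).radical.IsMaximal → RingTheory.Sequence.IsWeaklyRegular (X₁.presheaf.stalk x) (List.ofFn s)) →
      Set.Finite {x : X₁ | ¬ ∀ d : ℕ, ringKrullDim (X₁.presheaf.stalk x) = d → ∀ s : Fin d → X₁.presheaf.stalk x, (Ideal.span (Set.range s)).radical.IsMaximal → ∀ y : X₁.presheaf.stalk x, (∃ e : ℕ, y ^ p ^ e ∈ Ideal.span ((fun z : X₁.presheaf.stalk x => z ^ p ^ e) '' (Ideal.span (Set.range s) : Set (X₁.presheaf.stalk x)))) → y ∈ Ideal.span (Set.range s)} →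
      ∀ b : X₁, (¬ ∀ d : ℕ, ringKrullDim (X₁.presheaf.stalk b) = d → ∀ s : Fin d → X₁.presheaf.stalk b, (Ideal.span (Set.range s)).radical.IsMaximal → ∀ y : X₁.presheaf.stalk b, (∃ e : ℕ, y ^ p ^ e ∈ Ideal.span ((fun z : X₁.presheaf.stalk b => z ^ p ^ e) '' (Ideal.span (Set.range s) : Set (X₁.presheaf.stalk b)))) → y ∈ Ideal.span (Set.range s)) →
      (∀ W : X₁.Opens, b ∈ W → ∃ U : X₁.affineOpens, (U : X₁.Opens) ≤ W ∧ b ∈ (U : X₁.Opens) ∧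
        (∀ x : X₁, x ∈ (U : X₁.Opens) → x ≠ b → ∀ d : ℕ, ringKrullDim (X₁.presheaf.stalk x) = d → ∀ s : Fin d → X₁.presheaf.stalk x, (Ideal.span (Set.range s)).radical.IsMaximal → ∀ y : X₁.presheaf.stalk x, (∃ e : ℕ, y ^ p ^ e ∈ Ideal.span ((fun z : X₁.presheaf.stalk x => z ^ p ^ e) '' (Ideal.span (Set.range s) : Set (X₁.presheaf.stalk x)))) → y ∈ Ideal.span (Set.range s)) ∧
        CharP Γ(X₁, U) p ∧ ∃ (I : Ideal Γ(X₁, U)), I ≠ ⊥ ∧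
        (∀ (x : X₁) (hx : x ∈ (U : X₁.Opens)), I ≤ (U.2.primeIdealOf ⟨x, hx⟩).asIdeal ↔ x = b) ∧
        ∃ (t : ℕ) (v : Fin t → Γ(X₁, U)) (hv : ∀ j : Fin t, v j ∈ I),
          (HomogeneousIdeal.irrelevant (reesGrading I)).toIdeal ≤ (Ideal.span (Set.range fun j : Fin t => reesT (I := I) (v j) (hv j))).radical ∧
          (∀ j : Fin t, v j ≠ 0) ∧
          ∀ (j : Fin t) (Q : Ideal (Literature.AlgebraicGeometry.Resolution.blowupAlgebra I (v j))) [Q.IsMaximal],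
            algebraMap Γ(X₁, U) (Literature.AlgebraicGeometry.Resolution.blowupAlgebra I (v j)) (v j) ∈ Q →
            ∀ d : ℕ, ringKrullDim (Localization.AtPrime Q) = d → ∀ s : Fin d → Localization.AtPrime Q, (Ideal.span (Set.range s)).radical.IsMaximal → RingTheory.Sequence.IsWeaklyRegular (Localization.AtPrime Q) (List.ofFn s) ∧ ∀ y : Localization.AtPrime Q, (∃ e : ℕ, y ^ p ^ e ∈ Ideal.span ((fun z : Localization.AtPrime Q => z ^ p ^ e) '' (Ideal.span (Set.range s) : Set (Localization.AtPrime Q)))) → y ∈ Ideal.span (Set.range s)) →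
      (∃ (n : ℕ) (c : Fin n → X₁.presheaf.stalk b), Ideal.span (Set.range c) ≠ ⊥ ∧ (Ideal.span (Set.range c)).radical = IsLocalRing.maximalIdeal (X₁.presheaf.stalk b) ∧
        ∀ (j : Fin n) (𝔔 : PrimeSpectrum (Literature.AlgebraicGeometry.Resolution.blowupAlgebra (Ideal.span (Set.range c)) (c j))),
          𝔔.asIdeal.comap (algebraMap (X₁.presheaf.stalk b) (Literature.AlgebraicGeometry.Resolution.blowupAlgebra (Ideal.span (Set.range c)) (c j))) = IsLocalRing.maximalIdeal (X₁.presheaf.stalk b) →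
          IsDomain (Localization.AtPrime 𝔔.asIdeal) ∧ ∀ d : ℕ, ringKrullDim (Localization.AtPrime 𝔔.asIdeal) = d → ∀ s : Fin d → Localization.AtPrime 𝔔.asIdeal, (Ideal.span (Set.range s)).radical.IsMaximal → RingTheory.Sequence.IsWeaklyRegular (Localization.AtPrime 𝔔.asIdeal) (List.ofFn s) ∧ ∀ y : Localization.AtPrime 𝔔.asIdeal, (∃ e : ℕ, y ^ p ^ e ∈ Ideal.span ((fun z : Localization.AtPrime 𝔔.asIdeal => z ^ p ^ e) '' (Ideal.span (Set.range s) : Set (Localization.AtPrime 𝔔.asIdeal)))) → y ∈ Ideal.span (Set.range s)) := by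
  intro p hp k _ _ X₁ f₁ _ hft hqc hint hCM _ b _ hP
  haveI : Fact p.Prime := ⟨hp⟩
  haveI : IsNoetherian X₁ := ClosedPointsOfClosedFinite.isNoetherian_of_locallyOfFiniteType_of_quasiCompact f₁
  -- a certified chart around `b` (inside `W = ⊤`)
  obtain ⟨U, -, hbU, hF, hchar, I, hI0, hzero, hon⟩ := hP ⊤ trivial
  -- `b` is closed; the point-centre ideal sheaf `J` of `I`
  have hb : IsClosed ({b} : Set X₁) := isClosed_singleton_of_zeroLocus f₁ U I b hbU hzero
  obtain ⟨J, hJU, hsupp, -⟩ := PointCentreIdealSheaf.stub_pointCentreIdealSheaf X₁ U I b hbU hb hzero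
  subst hJU
  -- the full clause off `b` on `U`
  have hoffU : ∀ x : X₁, x ∈ (U : X₁.Opens) → x ≠ b →
      IsDomain (X₁.presheaf.stalk x) ∧ ∀ d : ℕ, ringKrullDim (X₁.presheaf.stalk x) = d →
        ∀ s : Fin d → X₁.presheaf.stalk x, (Ideal.span (Set.range s)).radical.IsMaximal →
          RingTheory.Sequence.IsWeaklyRegular (X₁.presheaf.stalk x) (List.ofFn s) ∧
          ∀ y : X₁.presheaf.stalk x, (∃ e : ℕ, y ^ p ^ e ∈ Ideal.span
            ((fun z : X₁.presheaf.stalk x => z ^ p ^ e) ''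
              (Ideal.span (Set.range s) : Set (X₁.presheaf.stalk x)))) → y ∈ Ideal.span (Set.range s) :=
    fun x hxU hxb => ⟨inferInstance, fun d hd s hs => ⟨hCM x d hd s hs, hF x hxU hxb d hd s hs⟩⟩
  -- `Γ(X₁, U)` is a Noetherian domain of characteristic `p`
  haveI : Nonempty (U : X₁.Opens) := ⟨⟨b, hbU⟩⟩
  haveI : IsDomain Γ(X₁, U) := IsIntegral.component_integral (U : X₁.Opens)
  haveI : IsNoetherianRing Γ(X₁, U) := IsLocallyNoetherian.component_noetherian U
  haveI : CharP Γ(X₁, U) p := hchar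
  -- generators of `I = J(U)` and their germs `c`
  obtain ⟨n, g, hg⟩ := Submodule.fg_iff_exists_fin_generating_family.mp (IsNoetherian.noetherian (J.ideal U))
  replace hg : Ideal.span (Set.range g) = J.ideal U := hg
  let c : Fin n → X₁.presheaf.stalk b := fun i => X₁.presheaf.germ U b hbU (g i)
  have hcI : Ideal.span (Set.range c) = (J.ideal U).map (X₁.presheaf.germ U b hbU).hom := by
    rw [← hg, Ideal.map_span, ← Set.range_comp]
    rfl
  have hc : Ideal.span (Set.range c) = stalkIdeal J b := by
    rw [hcI, stalkIdeal_eq_map_germ J U hbU]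
  refine ⟨n, c, ?_, ?_, ?_⟩
  · -- `(c) ≠ 0`: germs are injective on the integral scheme `X₁`, and `I ≠ 0`
    intro h0
    apply hI0
    rw [← hg, Ideal.span_eq_bot]
    rintro _ ⟨i, rfl⟩
    have hci : c i = 0 := (Ideal.span_eq_bot.mp h0) (c i) ⟨i, rfl⟩
    exact germ_injective_of_isIntegral X₁ b hbU (by
      change c i = X₁.presheaf.germ U b hbU 0
      rw [hci, map_zero])
  · -- `√(c) = 𝔪_b`
    rw [hcI]
    exact radical_map_germ_eq_maximalIdeal U (J.ideal U) b hbU hzero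
  · -- every prime of every chart algebra over `𝔪_b` is the local ring of a point of a blowing up along `J` over `b`
    intro j 𝔔 h𝔔
    obtain ⟨X', π, hπ⟩ := exists_isBlowup X₁ J
    obtain ⟨x', hx', ⟨e₁⟩⟩ := hπ.exists_point_of_blowupAlgebra_prime b c hc j 𝔔 h𝔔
    -- the stalk of `X'` at `x'` is a stalk of `affineBlowup (J(U))`, and those satisfy the full clause (§2a)
    obtain ⟨y, ⟨e₂⟩⟩ := BlowupStalkOverAffine.stub_blowupStalkOverAffine X₁ X' J π hπ U x' (hx' ▸ hbU)
    obtain ⟨t, v, hv, hcov, hv0, hcharts⟩ := hon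
    have hoff' := ClauseOffCentre.stub_clauseOffCentre p X₁ J U fun z hzU hz => hoffU z hzU (by
      intro hzb
      apply hz
      rw [hsupp, hzb]
      exact Set.mem_singleton b)
    have hall := CertifiedChartCentre.affineBlowupStalkClauseOfCover p Γ(X₁, U) (J.ideal U) t v hv hI0 hv0 hcov
      (fun P _ hP => hoff' P hP) hcharts y
    exact fiClause_of_ringEquiv p (B := Localization.AtPrime 𝔔.asIdeal) e₁ (fiClause_of_ringEquiv p e₂.symm hall)

end Summit.ResolutionOfSingularities.ResolutionOfSingularities.Theorems.FInjectiveMacaulayfication.CertifiedChartPointFixable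

end
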